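import Literature.NumberTheory.Sieve.BombieriFriedlanderIwaniecDispersionS2
import Literature.NumberTheory.Sieve.BombieriFriedlanderIwaniecTheorem5Assembly
import HarnessLib

/-!
# Bombieri–Friedlander–Iwaniec 1986, Theorem 1: the error terms `ℛ₃` (4.2) and `ℛ₂` (5.4), averaged

Topic `Literature/NumberTheory/Sieve`.  Part of the ASSEMBLY of the proof of Theorem 1 of
E. Bombieri, J. B. Friedlander, H. Iwaniec, *Primes in arithmetic progressions to large moduli*,
Acta Math. 156 (1986), 203–251, from the files `…DispersionSmoothing` (§3), `…DispersionS3` (§4),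
`…DispersionS2` (§5), `…DispersionS1`, `…DispersionS1Rest` (§6), `…DispersionMainTerm` (§7),
`…Theorem1R1` (§8) and `…Lemma6` (Lemma 6 from Lemma 1).  Those files bound the pieces of
Linnik's dispersion `𝒢 ≤ 𝒢* = 𝒮₁ − 2𝒮₂ + 𝒮₃` by explicit, UN-AVERAGED finite sums; here the two
easiest ones are averaged over the moduli with the weights `|γ_q| ≤ τ(q)^B` of (A₃):

* `BFI.norm_dS3_sub_mainX_le_avg` — (4.2) p. 216, "`ℛ₃ ≪ N‖β‖²R⁻¹ℒ^B`": for BFI's weight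
  `f = bump M (M/2)`,
  `‖𝒮₃ − f̂(0)X‖ ≤ (8 + K₂) · 3N‖β‖² · 4096 C₀^{2B+7} x^{3ε₁/4} / R`;
* `BFI.norm_dS2_sub_mainX_le_avg` — (5.4) p. 218 in the range of Theorem 1 (no frequencies
  `0 < |h| ≤ H₀`, cf. `…DispersionS2`): for `V ≥ 1`, `j ≥ 2` and `4VQR ≤ θ π M`,
  `‖𝒮₂ − f̂(0)X‖ ≤ 3N‖β‖² · 4096 C₀^{2B+3} x^{3ε₁/4} · ((8 K_j M θʲ + 1) Q + 9M/(2VR))`.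

Here `τ(n) ≤ C₀ n^ν` is the divisor bound (hypothesis `hτ`, from `DivisorBound` in the final
assembly), `Q, R ≤ 2x`, and `ν(B+3) ≤ ε₁/4` makes every divisor sum cost at most `x^{ε₁/4}`
(`BFI.sum_dyadic_sigma_rpow_le_x`, `…_div_le_x` of `…Theorem5Assembly`).  Both errors save a
power of `x` against the target `‖β‖² x R⁻¹ ℒ^{−A}` of (3.3) (`N ≤ x^{1−ε}`, `NQR < x^{1−3ε}`), so the
crude divisor bound suffices.  Everything here is PROVED; no named facts are introduced.

## References

* E. Bombieri, J. B. Friedlander, H. Iwaniec, Acta Math. 156 (1986), 203–251, §4 (4.2) p. 216,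
  §5 (5.2)–(5.4) pp. 216–218. [BombieriFriedlanderIwaniecActa1986]
-/

noncomputable section

open Finset Real
open scoped ArithmeticFunction.sigma

namespace Literature.NumberTheory.Sieve

namespace BFI

/-! ### Small algebraic helpers on the divisor weights -/

/-- `τ(q) ≥ 1` as a real number, for `q ≥ 1`. [folklore] -/
theorem one_le_sigma_zero_real {q : ℕ} (hq : 0 < q) : (1 : ℝ) ≤ (σ 0 q : ℝ) := by
  exact_mod_cast one_le_sigma_zero hq.ne'

/-- `τ(q)^B · τ(q) · τ(q) = τ(q)^{B+2}` (real powers, `q ≥ 1`). [folklore] -/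
theorem sigma_rpow_mul_mul {q : ℕ} (hq : 0 < q) (B : ℝ) :
    (σ 0 q : ℝ) ^ B * (σ 0 q : ℝ) * (σ 0 q : ℝ) = (σ 0 q : ℝ) ^ (B + 2) := by
  have h0 : (σ 0 q : ℝ) ≠ 0 := by have := one_le_sigma_zero_real hq; positivity
  rw [show B + 2 = B + ((2 : ℕ) : ℝ) by norm_num, Real.rpow_add_natCast h0, pow_two]
  ring

/-- `τ(q)^B · τ(q) = τ(q)^{B+1}` (real powers, `q ≥ 1`). [folklore] -/
theorem sigma_rpow_mul {q : ℕ} (hq : 0 < q) (B : ℝ) :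
    (σ 0 q : ℝ) ^ B * (σ 0 q : ℝ) = (σ 0 q : ℝ) ^ (B + 1) := by
  have h0 : (0 : ℝ) < (σ 0 q : ℝ) := by have := one_le_sigma_zero_real hq; positivity
  rw [Real.rpow_add_one h0.ne']

/-- `τ(r)·τ(r)·τ(r) = τ(r)^3` as a real power. [folklore] -/
theorem sigma_mul_mul_eq_rpow_three (r : ℕ) :
    (σ 0 r : ℝ) * (σ 0 r : ℝ) * (σ 0 r : ℝ) = (σ 0 r : ℝ) ^ (3 : ℝ) := by
  rw [show (3 : ℝ) = ((3 : ℕ) : ℝ) by norm_num, Real.rpow_natCast]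
  ring

/-- `(∑_{n∼N} |β_n|)² ≤ 3N ‖β‖²` for `N ≥ 1`. [folklore] -/
theorem sq_sum_abs_le {N : ℝ} (hN : 1 ≤ N) (β : ℕ → ℝ) :
    (∑ n ∈ dyadic N, |β n|) ^ 2 ≤ 3 * N * l2Sq N β := by
  have h := sum_abs_le_sqrt_mul hN β
  have h0 : 0 ≤ ∑ n ∈ dyadic N, |β n| := Finset.sum_nonneg fun _ _ => abs_nonneg _
  have hl := l2Sq_nonneg N β
  calc (∑ n ∈ dyadic N, |β n|) ^ 2 ≤ (Real.sqrt (3 * N) * Real.sqrt (l2Sq N β)) ^ 2 :=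
        pow_le_pow_left₀ h0 h 2
    _ = 3 * N * l2Sq N β := by
        rw [mul_pow, Real.sq_sqrt (by linarith), Real.sq_sqrt hl]

/-- `∑_{r∼R} τ(r)^s/(R r) ≤ 16 C₀^s x^{ε₁/4} / R` in the regime. [folklore] -/
theorem sum_dyadic_sigma_rpow_div_R_le_x {C₀ ν : ℝ} (hC₀ : 1 ≤ C₀) (hν : 0 ≤ ν)
    (hτ : ∀ n : ℕ, n ≠ 0 → ((σ 0 n : ℕ) : ℝ) ≤ C₀ * (n : ℝ) ^ ν) {R x ε₁ s : ℝ} (hR : 1 / 2 ≤ R)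
    (hRx : R ≤ 2 * x) (hx : 1 ≤ x) (hs : 0 ≤ s) (hνs : ν * s ≤ ε₁ / 4) (hε₁ : ε₁ ≤ 4) :
    ∑ r ∈ dyadic R, (σ 0 r : ℝ) ^ s / (R * r) ≤ 16 * C₀ ^ s * x ^ (ε₁ / 4) / R := by
  have hR0 : 0 < R := by linarith
  have e : ∀ r : ℕ, (σ 0 r : ℝ) ^ s / (R * r) = R⁻¹ * ((σ 0 r : ℝ) ^ s / r) := by
    intro r; rw [mul_comm R, ← div_div, div_eq_mul_inv _ R, mul_comm]
  simp only [e, ← Finset.mul_sum]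
  rw [div_eq_mul_inv _ R, mul_comm _ R⁻¹]
  exact mul_le_mul_of_nonneg_left (sum_dyadic_sigma_rpow_div_le_x hC₀ hν hτ hR hRx hx hs hνs hε₁)
    (by positivity)

/-! ### `ℛ₃` averaged (BFI (4.2)) -/

/-- The summand of the un-averaged bound for `𝒮₃` (`BFI.norm_dS3_sub_mainX_le`), bounded through
(A₃), `τ(q₁q₂r) ≤ τ(q₁)τ(q₂)τ(r)`, `(∑|β|)² ≤ 3N‖β‖²` and `1/φ(qr) ≤ τ(q)τ(r)/(qr)`:
`|γ_{q₁}γ_{q₂}| τ(q₁q₂r)(∑|β|)²/(φ(q₁r)φ(q₂r)) ≤ 3N‖β‖² (τ(q₁)^{B+2}/q₁)(τ(q₂)^{B+2}/q₂)(τ(r)³/(Rr))`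
for `r > R > 0`. [cite: BombieriFriedlanderIwaniecActa1986, §4 (4.2) p. 216] -/
theorem dS3_term_le {N R B : ℝ} (hN : 1 ≤ N) (hR : 0 < R) {γ : ℕ → ℝ}
    (hγ : ∀ q, |γ q| ≤ (σ 0 q : ℝ) ^ B) (β : ℕ → ℝ) {q₁ q₂ r : ℕ} (hq₁ : 0 < q₁) (hq₂ : 0 < q₂)
    (hr : 0 < r) (hRr : R ≤ r) :
    |γ q₁| * |γ q₂| * (σ 0 (q₁ * q₂ * r) : ℝ) * (∑ n ∈ dyadic N, |β n|) ^ 2 /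
        ((Nat.totient (q₁ * r) : ℝ) * (Nat.totient (q₂ * r) : ℝ)) ≤
      3 * N * l2Sq N β * ((σ 0 q₁ : ℝ) ^ (B + 2) / q₁) * ((σ 0 q₂ : ℝ) ^ (B + 2) / q₂) *
        ((σ 0 r : ℝ) ^ (3 : ℝ) / (R * r)) := by
  have hτ3 : (σ 0 (q₁ * q₂ * r) : ℝ) ≤ (σ 0 q₁ : ℝ) * (σ 0 q₂ : ℝ) * (σ 0 r : ℝ) := by
    have h1 := sigma_zero_mul_le (q₁ * q₂) r
    have h2 := sigma_zero_mul_le q₁ q₂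
    calc (σ 0 (q₁ * q₂ * r) : ℝ) ≤ ((σ 0 (q₁ * q₂) * σ 0 r : ℕ) : ℝ) := by exact_mod_cast h1
      _ ≤ ((σ 0 q₁ * σ 0 q₂ * σ 0 r : ℕ) : ℝ) := by
          exact_mod_cast Nat.mul_le_mul_right _ h2
      _ = _ := by push_cast; ring
  have hφ₁ := inv_totient_mul_le hq₁ hr
  have hφ₂ := inv_totient_mul_le hq₂ hr
  have hφ₁0 : (0 : ℝ) < (Nat.totient (q₁ * r) : ℝ) := by
    exact_mod_cast Nat.totient_pos.2 (Nat.mul_pos hq₁ hr)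
  have hφ₂0 : (0 : ℝ) < (Nat.totient (q₂ * r) : ℝ) := by
    exact_mod_cast Nat.totient_pos.2 (Nat.mul_pos hq₂ hr)
  have hS := sq_sum_abs_le hN β
  have hτ₁ := one_le_sigma_zero_real hq₁
  have hτ₂ := one_le_sigma_zero_real hq₂
  have hτr := one_le_sigma_zero_real hr
  have hr0 : (0 : ℝ) < r := by exact_mod_cast hr
  have hl := l2Sq_nonneg N β
  calc |γ q₁| * |γ q₂| * (σ 0 (q₁ * q₂ * r) : ℝ) * (∑ n ∈ dyadic N, |β n|) ^ 2 /
        ((Nat.totient (q₁ * r) : ℝ) * (Nat.totient (q₂ * r) : ℝ))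
      = |γ q₁| * |γ q₂| * (σ 0 (q₁ * q₂ * r) : ℝ) * (∑ n ∈ dyadic N, |β n|) ^ 2 *
          (((Nat.totient (q₁ * r) : ℝ))⁻¹ * ((Nat.totient (q₂ * r) : ℝ))⁻¹) := by
        rw [div_eq_mul_inv, mul_inv]
    _ ≤ (σ 0 q₁ : ℝ) ^ B * (σ 0 q₂ : ℝ) ^ B * ((σ 0 q₁ : ℝ) * (σ 0 q₂ : ℝ) * (σ 0 r : ℝ)) *
          (3 * N * l2Sq N β) *
          (((σ 0 q₁ : ℝ) * (σ 0 r : ℝ) / ((q₁ : ℝ) * r)) *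
            ((σ 0 q₂ : ℝ) * (σ 0 r : ℝ) / ((q₂ : ℝ) * r))) := by
        gcongr
        · exact hγ q₁
        · exact hγ q₂
    _ = 3 * N * l2Sq N β * ((σ 0 q₁ : ℝ) ^ B * (σ 0 q₁ : ℝ) * (σ 0 q₁ : ℝ) / q₁) *
          ((σ 0 q₂ : ℝ) ^ B * (σ 0 q₂ : ℝ) * (σ 0 q₂ : ℝ) / q₂) *
          ((σ 0 r : ℝ) * (σ 0 r : ℝ) * (σ 0 r : ℝ) / ((r : ℝ) * r)) := by
        field_simp
    _ ≤ 3 * N * l2Sq N β * ((σ 0 q₁ : ℝ) ^ B * (σ 0 q₁ : ℝ) * (σ 0 q₁ : ℝ) / q₁) *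
          ((σ 0 q₂ : ℝ) ^ B * (σ 0 q₂ : ℝ) * (σ 0 q₂ : ℝ) / q₂) *
          ((σ 0 r : ℝ) * (σ 0 r : ℝ) * (σ 0 r : ℝ) / (R * r)) := by
        gcongr
    _ = _ := by
        rw [sigma_rpow_mul_mul hq₁, sigma_rpow_mul_mul hq₂, sigma_mul_mul_eq_rpow_three r]

/-- **`ℛ₃` averaged** (BFI (4.2), p. 216: "The error term `ℛ₃` is bounded by `ℛ₃ ≪ N‖β‖²R⁻¹ℒ^B`
which is admissible for (3.3)"), here with the divisor bound in place of `ℒ^B`: for BFI's weight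
`f = bump M (M/2)` (`M > 0`), `N ≥ 1`, `1/2 ≤ Q, R ≤ 2x`, `x ≥ 1`, `|γ_q| ≤ τ(q)^B` and the divisor
bound `τ(n) ≤ C₀ n^ν` with `ν(B+3) ≤ ε₁/4 ≤ 1`,
`‖𝒮₃ − α̂₀ X‖ ≤ (8 + K₂) · 3N‖β‖² · 4096 C₀^{2B+7} x^{3ε₁/4} / R`.
[cite: BombieriFriedlanderIwaniecActa1986, §4 (4.2) p. 216] -/
theorem norm_dS3_sub_mainX_le_avg {C₀ ν : ℝ} (hC₀ : 1 ≤ C₀) (hν : 0 ≤ ν)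
    (hτ : ∀ n : ℕ, n ≠ 0 → ((σ 0 n : ℕ) : ℝ) ≤ C₀ * (n : ℝ) ^ ν) (a : ℤ) {M N Q R x ε₁ B : ℝ}
    (hM : 0 < M) (hN : 1 ≤ N) (hQ : 1 / 2 ≤ Q) (hR : 1 / 2 ≤ R) (hQx : Q ≤ 2 * x)
    (hRx : R ≤ 2 * x) (hx : 1 ≤ x) (hB : 0 ≤ B) (hνB : ν * (B + 3) ≤ ε₁ / 4) (hε₁ : ε₁ ≤ 4)
    {γ : ℕ → ℝ} (hγ : ∀ q, |γ q| ≤ (σ 0 q : ℝ) ^ B) (β : ℕ → ℝ) :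
    ‖(dS3 a (mRange M (M / 2)) N Q R (fun m => bump M (M / 2) m) β γ : ℂ) -
        alphaHat M (M / 2) * (mainX a N Q R β γ : ℂ)‖ ≤
      (8 + derivConst 2) * (3 * N * l2Sq N β) *
        (4096 * C₀ ^ (2 * B + 7) * x ^ (3 * ε₁ / 4)) / R := by
  have hY : 0 < M / 2 := by positivity
  have hYM : M / 2 ≤ M := by linarith
  have hQ0 : 0 < Q := by linarith
  have hR0 : 0 < R := by linarith
  have hl := l2Sq_nonneg N β
  refine (norm_dS3_sub_mainX_le hY hYM a hQ0.le hR0.le β γ).trans ?_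
  have e8 : 2 * (M + 2 * (M / 2)) / (M / 2) = 8 := by field_simp; ring
  rw [e8]
  -- the triple sum
  set fQ : ℕ → ℝ := fun q => (σ 0 q : ℝ) ^ (B + 2) / q with hfQ
  set fR : ℕ → ℝ := fun r => (σ 0 r : ℝ) ^ (3 : ℝ) / (R * r) with hfR
  have hsum : ∑ r ∈ dyadic R, ∑ q₁ ∈ dyadic Q, ∑ q₂ ∈ dyadic Q,
      |γ q₁| * |γ q₂| * (σ 0 (q₁ * q₂ * r) : ℝ) * (∑ n ∈ dyadic N, |β n|) ^ 2 /
        ((Nat.totient (q₁ * r) : ℝ) * (Nat.totient (q₂ * r) : ℝ)) ≤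
      3 * N * l2Sq N β * ((∑ q ∈ dyadic Q, fQ q) * (∑ q ∈ dyadic Q, fQ q) *
        ∑ r ∈ dyadic R, fR r) := by
    calc ∑ r ∈ dyadic R, ∑ q₁ ∈ dyadic Q, ∑ q₂ ∈ dyadic Q,
          |γ q₁| * |γ q₂| * (σ 0 (q₁ * q₂ * r) : ℝ) * (∑ n ∈ dyadic N, |β n|) ^ 2 /
            ((Nat.totient (q₁ * r) : ℝ) * (Nat.totient (q₂ * r) : ℝ))
        ≤ ∑ r ∈ dyadic R, ∑ q₁ ∈ dyadic Q, ∑ q₂ ∈ dyadic Q,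
            3 * N * l2Sq N β * fQ q₁ * fQ q₂ * fR r := by
          refine Finset.sum_le_sum fun r hr => Finset.sum_le_sum fun q₁ hq₁ =>
            Finset.sum_le_sum fun q₂ hq₂ => ?_
          have hr' := (mem_dyadic hR0.le).1 hr
          exact dS3_term_le hN hR0 hγ β (pos_of_mem_dyadic hQ0.le hq₁) (pos_of_mem_dyadic hQ0.le hq₂)
            (pos_of_mem_dyadic hR0.le hr) hr'.1.le
      _ = 3 * N * l2Sq N β * ((∑ q ∈ dyadic Q, fQ q) * (∑ q ∈ dyadic Q, fQ q) *
            ∑ r ∈ dyadic R, fR r) := by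
          simp only [← Finset.sum_mul, ← Finset.mul_sum]
          ring
  -- the dyadic divisor sums
  have hs2 : 0 ≤ B + 2 := by linarith
  have hν2 : ν * (B + 2) ≤ ε₁ / 4 := le_trans (by nlinarith) hνB
  have hν3 : ν * 3 ≤ ε₁ / 4 := le_trans (by nlinarith) hνB
  have hSQ : ∑ q ∈ dyadic Q, fQ q ≤ 16 * C₀ ^ (B + 2) * x ^ (ε₁ / 4) :=
    sum_dyadic_sigma_rpow_div_le_x hC₀ hν hτ hQ hQx hx hs2 hν2 hε₁
  have hSR : ∑ r ∈ dyadic R, fR r ≤ 16 * C₀ ^ (3 : ℝ) * x ^ (ε₁ / 4) / R :=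
    sum_dyadic_sigma_rpow_div_R_le_x hC₀ hν hτ hR hRx hx (by norm_num) hν3 hε₁
  have hSQ0 : 0 ≤ ∑ q ∈ dyadic Q, fQ q := Finset.sum_nonneg fun q _ => by positivity
  have hSR0 : 0 ≤ ∑ r ∈ dyadic R, fR r := Finset.sum_nonneg fun r _ => by
    simp only [hfR]; positivity
  have hK := one_le_derivConst 2
  have hx0 : 0 < x := by linarith
  have hC₀0 : 0 < C₀ := by linarith
  refine (mul_le_mul_of_nonneg_left hsum (by positivity)).trans ?_
  have hprod : (∑ q ∈ dyadic Q, fQ q) * (∑ q ∈ dyadic Q, fQ q) * ∑ r ∈ dyadic R, fR r ≤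
      (16 * C₀ ^ (B + 2) * x ^ (ε₁ / 4)) * (16 * C₀ ^ (B + 2) * x ^ (ε₁ / 4)) *
        (16 * C₀ ^ (3 : ℝ) * x ^ (ε₁ / 4) / R) :=
    mul_le_mul (mul_le_mul hSQ hSQ hSQ0 (by positivity)) hSR hSR0 (by positivity)
  have e : (16 * C₀ ^ (B + 2) * x ^ (ε₁ / 4)) * (16 * C₀ ^ (B + 2) * x ^ (ε₁ / 4)) *
      (16 * C₀ ^ (3 : ℝ) * x ^ (ε₁ / 4) / R) =
        4096 * C₀ ^ (2 * B + 7) * x ^ (3 * ε₁ / 4) / R := by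
    have h1 : C₀ ^ (B + 2) * C₀ ^ (B + 2) * C₀ ^ (3 : ℝ) = C₀ ^ (2 * B + 7) := by
      rw [← Real.rpow_add hC₀0, ← Real.rpow_add hC₀0]; ring_nf
    have h2 : x ^ (ε₁ / 4) * x ^ (ε₁ / 4) * x ^ (ε₁ / 4) = x ^ (3 * ε₁ / 4) := by
      rw [← Real.rpow_add hx0, ← Real.rpow_add hx0]; ring_nf
    calc (16 * C₀ ^ (B + 2) * x ^ (ε₁ / 4)) * (16 * C₀ ^ (B + 2) * x ^ (ε₁ / 4)) *
          (16 * C₀ ^ (3 : ℝ) * x ^ (ε₁ / 4) / R)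
        = 4096 * (C₀ ^ (B + 2) * C₀ ^ (B + 2) * C₀ ^ (3 : ℝ)) *
            (x ^ (ε₁ / 4) * x ^ (ε₁ / 4) * x ^ (ε₁ / 4)) / R := by ring
      _ = _ := by rw [h1, h2]
  calc (8 + derivConst 2) * (3 * N * l2Sq N β * ((∑ q ∈ dyadic Q, fQ q) *
        (∑ q ∈ dyadic Q, fQ q) * ∑ r ∈ dyadic R, fR r))
      ≤ (8 + derivConst 2) * (3 * N * l2Sq N β *
          ((16 * C₀ ^ (B + 2) * x ^ (ε₁ / 4)) * (16 * C₀ ^ (B + 2) * x ^ (ε₁ / 4)) *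
            (16 * C₀ ^ (3 : ℝ) * x ^ (ε₁ / 4) / R))) := by
        gcongr
    _ = (8 + derivConst 2) * (3 * N * l2Sq N β) *
          (4096 * C₀ ^ (2 * B + 7) * x ^ (3 * ε₁ / 4)) / R := by
        rw [e]; ring

/-! ### `ℛ₂` averaged (BFI (5.4) in the range of Theorem 1) -/

/-- The summand of the un-averaged bound for `𝒮₂` (`BFI.norm_dS2_sub_mainX_le`, `Y = M/2`),
bounded through (A₃), `(∑|β|)² ≤ 3N‖β‖²` and `τ(q₂)/φ(q₂r) ≤ τ(q₂)²τ(r)/(q₂r)`: for `r ≥ R > 0`,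
`|γ_{q₁}γ_{q₂}|(∑|β|)² τ(q₂)/φ(q₂r) (T + (9M/2)/(Vq₁r) + 1)
  ≤ 3N‖β‖²(T+1) τ(q₁)^B (τ(q₂)^{B+2}/q₂)(τ(r)/r) + 3N‖β‖² (9M/(2V)) (τ(q₁)^B/q₁)(τ(q₂)^{B+2}/q₂)(τ(r)/(Rr))`.
[cite: BombieriFriedlanderIwaniecActa1986, §5 (5.4) p. 218] -/
theorem dS2_term_le {M N R B T V : ℝ} (hM : 0 ≤ M) (hN : 1 ≤ N) (hR : 0 < R) (hT : 0 ≤ T)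
    (hV : 0 < V) {γ : ℕ → ℝ} (hγ : ∀ q, |γ q| ≤ (σ 0 q : ℝ) ^ B) (β : ℕ → ℝ) {q₁ q₂ r : ℕ}
    (hq₁ : 0 < q₁) (hq₂ : 0 < q₂) (hr : 0 < r) (hRr : R ≤ r) :
    |γ q₁| * |γ q₂| * (∑ n ∈ dyadic N, |β n|) ^ 2 *
        ((σ 0 q₂ : ℝ) / (Nat.totient (q₂ * r) : ℝ)) *
        (T + (3 * M + 3 * (M / 2)) / (V * (q₁ * r : ℕ)) + 1) ≤
      3 * N * l2Sq N β * (T + 1) * (σ 0 q₁ : ℝ) ^ B * ((σ 0 q₂ : ℝ) ^ (B + 2) / q₂) *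
          ((σ 0 r : ℝ) / r) +
        3 * N * l2Sq N β * (9 * M / (2 * V)) * ((σ 0 q₁ : ℝ) ^ B / q₁) *
          ((σ 0 q₂ : ℝ) ^ (B + 2) / q₂) * ((σ 0 r : ℝ) / (R * r)) := by
  have hφ₂ := inv_totient_mul_le hq₂ hr
  have hφ₂0 : (0 : ℝ) < (Nat.totient (q₂ * r) : ℝ) := by
    exact_mod_cast Nat.totient_pos.2 (Nat.mul_pos hq₂ hr)
  have hS := sq_sum_abs_le hN β
  have hS0 : 0 ≤ ∑ n ∈ dyadic N, |β n| := Finset.sum_nonneg fun _ _ => abs_nonneg _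
  have hτ₁ := one_le_sigma_zero_real hq₁
  have hτ₂ := one_le_sigma_zero_real hq₂
  have hτr := one_le_sigma_zero_real hr
  have hr0 : (0 : ℝ) < r := by exact_mod_cast hr
  have hq₁0 : (0 : ℝ) < q₁ := by exact_mod_cast hq₁
  have hq₂0 : (0 : ℝ) < q₂ := by exact_mod_cast hq₂
  have hl := l2Sq_nonneg N β
  -- the common factor `u ≤ ū`
  set u : ℝ := |γ q₁| * |γ q₂| * (∑ n ∈ dyadic N, |β n|) ^ 2 *
    ((σ 0 q₂ : ℝ) / (Nat.totient (q₂ * r) : ℝ)) with hu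
  set ub : ℝ := (σ 0 q₁ : ℝ) ^ B * (σ 0 q₂ : ℝ) ^ B * (3 * N * l2Sq N β) *
    ((σ 0 q₂ : ℝ) * ((σ 0 q₂ : ℝ) * (σ 0 r : ℝ) / ((q₂ : ℝ) * r))) with hub
  have hu0 : 0 ≤ u := by rw [hu]; positivity
  have huub : u ≤ ub := by
    rw [hu, hub, div_eq_mul_inv (σ 0 q₂ : ℝ)]
    gcongr
    · exact hγ q₁
    · exact hγ q₂
  have hub0 : 0 ≤ ub := hu0.trans huub
  have hcast : ((q₁ * r : ℕ) : ℝ) = (q₁ : ℝ) * r := by push_cast; ring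
  rw [hcast]
  have e1 : ub * (T + 1) = 3 * N * l2Sq N β * (T + 1) * (σ 0 q₁ : ℝ) ^ B *
      ((σ 0 q₂ : ℝ) ^ (B + 2) / q₂) * ((σ 0 r : ℝ) / r) := by
    rw [hub, ← sigma_rpow_mul_mul hq₂]
    field_simp
  have e2 : ub * ((3 * M + 3 * (M / 2)) / (V * ((q₁ : ℝ) * r))) =
      3 * N * l2Sq N β * (9 * M / (2 * V)) * ((σ 0 q₁ : ℝ) ^ B / q₁) *
        ((σ 0 q₂ : ℝ) ^ (B + 2) / q₂) * ((σ 0 r : ℝ) / ((r : ℝ) * r)) := by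
    rw [hub, ← sigma_rpow_mul_mul hq₂]
    field_simp
    ring
  calc u * (T + (3 * M + 3 * (M / 2)) / (V * ((q₁ : ℝ) * r)) + 1)
      = u * (T + 1) + u * ((3 * M + 3 * (M / 2)) / (V * ((q₁ : ℝ) * r))) := by ring
    _ ≤ ub * (T + 1) + ub * ((3 * M + 3 * (M / 2)) / (V * ((q₁ : ℝ) * r))) := by
        gcongr
    _ = 3 * N * l2Sq N β * (T + 1) * (σ 0 q₁ : ℝ) ^ B * ((σ 0 q₂ : ℝ) ^ (B + 2) / q₂) *
          ((σ 0 r : ℝ) / r) +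
        3 * N * l2Sq N β * (9 * M / (2 * V)) * ((σ 0 q₁ : ℝ) ^ B / q₁) *
          ((σ 0 q₂ : ℝ) ^ (B + 2) / q₂) * ((σ 0 r : ℝ) / ((r : ℝ) * r)) := by rw [e1, e2]
    _ ≤ _ := by gcongr

/-- **`ℛ₂` averaged, in the range of Theorem 1** (BFI §5, (5.2)–(5.4) pp. 216–218; the
oscillatory terms `0 < |h| ≤ H₀` are absent since `H₀ < 1`, cf. `BFI.norm_dS2_sub_mainX_le`): for
BFI's weight `f = bump M (M/2)` (`M > 0`), `N ≥ 1`, `1/2 ≤ Q, R ≤ 2x`, `x ≥ 1`, `V ≥ 1`, `j ≥ 2`,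
`θ ≥ 0` with `4VQR ≤ θ π M` (so that every Poisson tail at a modulus `νq₁r ≤ 4VQR` is
`≤ 8 K_j M θʲ`), `|γ_q| ≤ τ(q)^B` and the divisor bound `τ(n) ≤ C₀n^ν`, `ν(B+3) ≤ ε₁/4 ≤ 1`:
`‖𝒮₂ − α̂₀X‖ ≤ 3N‖β‖² · 4096 C₀^{2B+3} x^{3ε₁/4} · ((8K_jMθʲ + 1) Q + 9M/(2VR))`.
[cite: BombieriFriedlanderIwaniecActa1986, §5 (5.4) p. 218] -/
theorem norm_dS2_sub_mainX_le_avg {C₀ ν : ℝ} (hC₀ : 1 ≤ C₀) (hν : 0 ≤ ν)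
    (hτ : ∀ n : ℕ, n ≠ 0 → ((σ 0 n : ℕ) : ℝ) ≤ C₀ * (n : ℝ) ^ ν) (a : ℤ) {M N Q R x ε₁ B V θ : ℝ}
    (hM : 0 < M) (hN : 1 ≤ N) (hQ : 1 / 2 ≤ Q) (hR : 1 / 2 ≤ R) (hQx : Q ≤ 2 * x)
    (hRx : R ≤ 2 * x) (hx : 1 ≤ x) (hB : 0 ≤ B) (hνB : ν * (B + 3) ≤ ε₁ / 4) (hε₁ : ε₁ ≤ 4)
    (hV : 1 ≤ V) {j : ℕ} (hj : 2 ≤ j) (hθ0 : 0 ≤ θ) (hθ : 4 * V * Q * R ≤ θ * (π * M))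
    {γ : ℕ → ℝ} (hγ : ∀ q, |γ q| ≤ (σ 0 q : ℝ) ^ B) (β : ℕ → ℝ) :
    ‖(dS2 a (mRange M (M / 2)) N Q R (fun m => bump M (M / 2) m) β γ : ℂ) -
        alphaHat M (M / 2) * (mainX a N Q R β γ : ℂ)‖ ≤
      3 * N * l2Sq N β * (4096 * C₀ ^ (2 * B + 3) * x ^ (3 * ε₁ / 4)) *
        ((8 * derivConst j * M * θ ^ j + 1) * Q + 9 * M / (2 * V * R)) := by
  have hY : 0 < M / 2 := by positivity
  have hYM : M / 2 ≤ M := by linarith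
  have hQ0 : 0 < Q := by linarith
  have hR0 : 0 < R := by linarith
  have hV0 : 0 < V := by linarith
  have hl := l2Sq_nonneg N β
  have hKj := one_le_derivConst j
  have hj1 : 1 ≤ j := le_trans (by norm_num) hj
  set T : ℝ := 8 * derivConst j * M * θ ^ j with hTdef
  have hT0 : 0 ≤ T := by positivity
  -- the Poisson tails at the moduli `ν q₁ r ≤ 4VQR`
  have htail : ∀ q₁ ∈ dyadic Q, ∀ q₂ ∈ dyadic Q, ∀ r ∈ dyadic R, ∀ ν' ∈ q₂.divisors,
      (ν' : ℝ) ≤ V → ((ν' : ℝ) * (q₁ * r : ℕ))⁻¹ * tailBound (M / 2) j (ν' * (q₁ * r)) 0 ≤ T := by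
    intro q₁ hq₁ q₂ hq₂ r hr ν' hν' hν'V
    have hq₁' := (mem_dyadic hQ0.le).1 hq₁
    have hr' := (mem_dyadic hR0.le).1 hr
    have hq₁0 := pos_of_mem_dyadic hQ0.le hq₁
    have hr0 := pos_of_mem_dyadic hR0.le hr
    have hν'0 : 0 < ν' := Nat.pos_of_mem_divisors hν'
    -- the ratio `k/(2πY) ≤ θ`
    have hk : ((ν' * (q₁ * r) : ℕ) : ℝ) ≤ 4 * V * Q * R := by
      push_cast
      have h1 : (q₁ : ℝ) * r ≤ 2 * Q * (2 * R) :=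
        mul_le_mul hq₁'.2 hr'.2 (by positivity) (by positivity)
      calc (ν' : ℝ) * ((q₁ : ℝ) * r) ≤ V * (2 * Q * (2 * R)) :=
            mul_le_mul hν'V h1 (by positivity) (by positivity)
        _ = 4 * V * Q * R := by ring
    have hθ' : ((ν' * (q₁ * r) : ℕ) : ℝ) / (2 * π * (M / 2) * (((0 : ℕ) : ℝ) + 1)) ≤ θ := by
      rw [Nat.cast_zero, zero_add, mul_one, div_le_iff₀ (by positivity)]
      calc ((ν' * (q₁ * r) : ℕ) : ℝ) ≤ 4 * V * Q * R := hk
        _ ≤ θ * (π * M) := hθ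
        _ = θ * (2 * π * (M / 2)) := by ring
    have htb := tailBound_le_of hY hj1 hθ'
    rw [Nat.cast_zero, zero_add, mul_one] at htb
    have hinv : ((ν' : ℝ) * (q₁ * r : ℕ))⁻¹ ≤ 1 := by
      refine inv_le_one_of_one_le₀ ?_
      have : (1 : ℝ) ≤ ((ν' * (q₁ * r) : ℕ) : ℝ) := by
        exact_mod_cast Nat.mul_pos hν'0 (Nat.mul_pos hq₁0 hr0)
      push_cast at this ⊢
      linarith
    have htb0 := tailBound_nonneg hY j (ν' * (q₁ * r)) 0
    calc ((ν' : ℝ) * (q₁ * r : ℕ))⁻¹ * tailBound (M / 2) j (ν' * (q₁ * r)) 0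
        ≤ 1 * (16 * derivConst j * (M / 2) * θ ^ j) :=
          mul_le_mul hinv htb htb0 zero_le_one
      _ = T := by rw [hTdef]; ring
  refine (norm_dS2_sub_mainX_le hY hYM a hQ0.le hR0.le β γ hV hj htail).trans ?_
  -- the triple sum, split in two
  set fB : ℕ → ℝ := fun q => (σ 0 q : ℝ) ^ B with hfB
  set fBq : ℕ → ℝ := fun q => (σ 0 q : ℝ) ^ B / q with hfBq
  set fQ : ℕ → ℝ := fun q => (σ 0 q : ℝ) ^ (B + 2) / q with hfQ
  set fR : ℕ → ℝ := fun r => (σ 0 r : ℝ) / r with hfR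
  set fRR : ℕ → ℝ := fun r => (σ 0 r : ℝ) / (R * r) with hfRR
  have hsum : ∑ r ∈ dyadic R, ∑ q₁ ∈ dyadic Q, ∑ q₂ ∈ dyadic Q,
      |γ q₁| * |γ q₂| * (∑ n ∈ dyadic N, |β n|) ^ 2 *
        ((σ 0 q₂ : ℝ) / (Nat.totient (q₂ * r) : ℝ)) *
        (T + (3 * M + 3 * (M / 2)) / (V * (q₁ * r : ℕ)) + 1) ≤
      3 * N * l2Sq N β * (T + 1) * ((∑ q ∈ dyadic Q, fB q) * (∑ q ∈ dyadic Q, fQ q) *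
          ∑ r ∈ dyadic R, fR r) +
        3 * N * l2Sq N β * (9 * M / (2 * V)) * ((∑ q ∈ dyadic Q, fBq q) *
          (∑ q ∈ dyadic Q, fQ q) * ∑ r ∈ dyadic R, fRR r) := by
    calc ∑ r ∈ dyadic R, ∑ q₁ ∈ dyadic Q, ∑ q₂ ∈ dyadic Q,
          |γ q₁| * |γ q₂| * (∑ n ∈ dyadic N, |β n|) ^ 2 *
            ((σ 0 q₂ : ℝ) / (Nat.totient (q₂ * r) : ℝ)) *
            (T + (3 * M + 3 * (M / 2)) / (V * (q₁ * r : ℕ)) + 1)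
        ≤ ∑ r ∈ dyadic R, ∑ q₁ ∈ dyadic Q, ∑ q₂ ∈ dyadic Q,
            (3 * N * l2Sq N β * (T + 1) * fB q₁ * fQ q₂ * fR r +
              3 * N * l2Sq N β * (9 * M / (2 * V)) * fBq q₁ * fQ q₂ * fRR r) := by
          refine Finset.sum_le_sum fun r hr => Finset.sum_le_sum fun q₁ hq₁ =>
            Finset.sum_le_sum fun q₂ hq₂ => ?_
          have hr' := (mem_dyadic hR0.le).1 hr
          exact dS2_term_le hM.le hN hR0 hT0 hV0 hγ β (pos_of_mem_dyadic hQ0.le hq₁)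
            (pos_of_mem_dyadic hQ0.le hq₂) (pos_of_mem_dyadic hR0.le hr) hr'.1.le
      _ = _ := by
          simp only [Finset.sum_add_distrib, ← Finset.sum_mul, ← Finset.mul_sum]
          ring
  -- the dyadic divisor sums
  have hs2 : 0 ≤ B + 2 := by linarith
  have hνB' : ν * B ≤ ε₁ / 4 := le_trans (by nlinarith) hνB
  have hν2 : ν * (B + 2) ≤ ε₁ / 4 := le_trans (by nlinarith) hνB
  have hν1 : ν * 1 ≤ ε₁ / 4 := le_trans (by nlinarith) hνB
  have hSB : ∑ q ∈ dyadic Q, fB q ≤ 16 * C₀ ^ B * Q * x ^ (ε₁ / 4) :=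
    sum_dyadic_sigma_rpow_le_x hC₀ hν hτ hQ hQx hx hB hνB' hε₁
  have hSBq : ∑ q ∈ dyadic Q, fBq q ≤ 16 * C₀ ^ B * x ^ (ε₁ / 4) :=
    sum_dyadic_sigma_rpow_div_le_x hC₀ hν hτ hQ hQx hx hB hνB' hε₁
  have hSQ : ∑ q ∈ dyadic Q, fQ q ≤ 16 * C₀ ^ (B + 2) * x ^ (ε₁ / 4) :=
    sum_dyadic_sigma_rpow_div_le_x hC₀ hν hτ hQ hQx hx hs2 hν2 hε₁
  have hSR : ∑ r ∈ dyadic R, fR r ≤ 16 * C₀ ^ (1 : ℝ) * x ^ (ε₁ / 4) := by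
    have h := sum_dyadic_sigma_rpow_div_le_x hC₀ hν hτ hR hRx hx zero_le_one hν1 hε₁
    simp only [Real.rpow_one] at h
    simpa [hfR] using h
  have hSRR : ∑ r ∈ dyadic R, fRR r ≤ 16 * C₀ ^ (1 : ℝ) * x ^ (ε₁ / 4) / R := by
    have h := sum_dyadic_sigma_rpow_div_R_le_x hC₀ hν hτ hR hRx hx zero_le_one hν1 hε₁
    simp only [Real.rpow_one] at h
    simpa [hfRR] using h
  have hSB0 : 0 ≤ ∑ q ∈ dyadic Q, fB q := Finset.sum_nonneg fun q _ => by positivity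
  have hSBq0 : 0 ≤ ∑ q ∈ dyadic Q, fBq q := Finset.sum_nonneg fun q _ => by positivity
  have hSQ0 : 0 ≤ ∑ q ∈ dyadic Q, fQ q := Finset.sum_nonneg fun q _ => by positivity
  have hSR0 : 0 ≤ ∑ r ∈ dyadic R, fR r := Finset.sum_nonneg fun r _ => by positivity
  have hSRR0 : 0 ≤ ∑ r ∈ dyadic R, fRR r := Finset.sum_nonneg fun r _ => by
    simp only [hfRR]; positivity
  have hx0 : 0 < x := by linarith
  have hC₀0 : 0 < C₀ := by linarith
  rw [Real.rpow_one] at hSR hSRR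
  have hP1 : (∑ q ∈ dyadic Q, fB q) * (∑ q ∈ dyadic Q, fQ q) * ∑ r ∈ dyadic R, fR r ≤
      (16 * C₀ ^ B * Q * x ^ (ε₁ / 4)) * (16 * C₀ ^ (B + 2) * x ^ (ε₁ / 4)) *
        (16 * C₀ * x ^ (ε₁ / 4)) :=
    mul_le_mul (mul_le_mul hSB hSQ hSQ0 (by positivity)) hSR hSR0 (by positivity)
  have hP2 : (∑ q ∈ dyadic Q, fBq q) * (∑ q ∈ dyadic Q, fQ q) * ∑ r ∈ dyadic R, fRR r ≤
      (16 * C₀ ^ B * x ^ (ε₁ / 4)) * (16 * C₀ ^ (B + 2) * x ^ (ε₁ / 4)) *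
        (16 * C₀ * x ^ (ε₁ / 4) / R) :=
    mul_le_mul (mul_le_mul hSBq hSQ hSQ0 (by positivity)) hSRR hSRR0 (by positivity)
  have hCC : C₀ ^ B * C₀ ^ (B + 2) * C₀ = C₀ ^ (2 * B + 3) := by
    rw [← Real.rpow_add hC₀0]
    nth_rewrite 2 [← Real.rpow_one C₀]
    rw [← Real.rpow_add hC₀0]; ring_nf
  have hxx : x ^ (ε₁ / 4) * x ^ (ε₁ / 4) * x ^ (ε₁ / 4) = x ^ (3 * ε₁ / 4) := by
    rw [← Real.rpow_add hx0, ← Real.rpow_add hx0]; ring_nf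
  have e1 : (16 * C₀ ^ B * Q * x ^ (ε₁ / 4)) * (16 * C₀ ^ (B + 2) * x ^ (ε₁ / 4)) *
      (16 * C₀ * x ^ (ε₁ / 4)) = 4096 * C₀ ^ (2 * B + 3) * x ^ (3 * ε₁ / 4) * Q := by
    rw [← hCC, ← hxx]; ring
  have e2 : (16 * C₀ ^ B * x ^ (ε₁ / 4)) * (16 * C₀ ^ (B + 2) * x ^ (ε₁ / 4)) *
      (16 * C₀ * x ^ (ε₁ / 4) / R) = 4096 * C₀ ^ (2 * B + 3) * x ^ (3 * ε₁ / 4) / R := by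
    rw [← hCC, ← hxx]; ring
  rw [e1] at hP1
  rw [e2] at hP2
  refine hsum.trans ?_
  calc 3 * N * l2Sq N β * (T + 1) * ((∑ q ∈ dyadic Q, fB q) * (∑ q ∈ dyadic Q, fQ q) *
          ∑ r ∈ dyadic R, fR r) +
        3 * N * l2Sq N β * (9 * M / (2 * V)) * ((∑ q ∈ dyadic Q, fBq q) *
          (∑ q ∈ dyadic Q, fQ q) * ∑ r ∈ dyadic R, fRR r)
      ≤ 3 * N * l2Sq N β * (T + 1) * (4096 * C₀ ^ (2 * B + 3) * x ^ (3 * ε₁ / 4) * Q) +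
        3 * N * l2Sq N β * (9 * M / (2 * V)) *
          (4096 * C₀ ^ (2 * B + 3) * x ^ (3 * ε₁ / 4) / R) := by
        gcongr
    _ = _ := by rw [hTdef]; field_simp


end BFI

end Literature.NumberTheory.Sieve
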